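import Literature.NumberTheory.EllipticCurves.Rubin1991.TwoVariableMainConjecture
import Literature.NumberTheory.EllipticCurves.Agboola2007.RestrictedSelmerGroups
import HarnessLib

/-!
# STUB-IDEAS k1 (gen 4) — `stub_heegnerIndexLowerAtTwo` of crux `PrintCf2.SplitBadTwoLowerHalfOfFacts`
# (stmt-BirchSwinnertonDyer-27851): typed sketch of the proposed step
# «line-free two-variable LOWER descent by Fitting base change»

Planner seat `sidea-stub_heegnerIndexLowerAtTwo-1-g4`, technique = weaken / strengthen. This file only TYPES the
helper lemmas of the idea card `Ideas/stub_heegnerIndexLowerAtTwo-k1.md` (gen 4); `sorry` appears only in the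
helper stubs `H_A0`, `H_A1`, `H_A4` (M-sized lemmas); the Koszul count `H_A5` and the bookkeeping lemma `lower_chain` are
PROVED.
Nothing here closes a stub, a crux or a route; BSD is not proved by any of this.

Dictionary (road α, lower half at `p = 2`): `Λ₂ = IwasawaAlgebra₂ 2 = ℤ₂⟦T₂⟧⟦T₁⟧`, `X = D_θ.X` the Pontryagin dual of
`H¹_{v̄}(K̃_∞, W*)` (Rubin 1991 two-variable carrier `DualData₂`), `G₂ = J''(ch X)` or any generator of the
Eisenstein side, the POINT `(a, b) = (r(γ₁⁻¹) − 1, r(γ₂⁻¹) − 1)` of the v10 frame (`stub_restrictedMainConj_two_v10`).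
-/

noncomputable section

open scoped Classical

set_option autoImplicit false
set_option linter.dupNamespace false

open NumberField IsDedekindDomain Field
open Literature.NumberTheory.GaloisRepresentations Literature.NumberTheory.EllipticCurves

namespace Summit.BirchSwinnertonDyer.BirchSwinnertonDyer.Cruxes.SplitBadTwoLowerHalfOfFacts.StubIdeasK1G4

/-! ## §1 The point ideal and the WEAKEST SUFFICIENT Eisenstein input `(E₂-Fitt♭)` -/

/-- The point ideal `𝔞_{a,b} = (T₁ − a, T₂ − b) ⊂ Λ₂` (outer variable `T₁ = PowerSeries.X`, inner variable
`T₂ = C X`). For `‖a‖, ‖b‖ < 1`, `Λ₂/𝔞_{a,b} ≅ ℤ₂` by `F ↦ F(a, b)`. -/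
def pointIdeal (a b : ℤ_[2]) : Ideal (IwasawaAlgebra₂ 2) :=
  Ideal.span {(PowerSeries.X : IwasawaAlgebra₂ 2) - PowerSeries.C (PowerSeries.C a),
    PowerSeries.C (PowerSeries.X : IwasawaAlgebra 2) - PowerSeries.C (PowerSeries.C b)}

/-- **`(E₂-Fitt♭)` — the weakest sufficient form of the two-variable main conjecture for the LOWER bound.**
`Fitt₀_{Λ₂}(X) · 𝓘⟦T₁,T₂⟧ ⊆ (G₂)`, spelled out by the definition of the initial Fitting ideal
(de Smit–Rubin–Schoof, *Criteria for complete intersections* §1 Prop. 1.1: the ideal generated by `det A` over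
all square relation matrices `A` of a finite generating family): for every generating family `x : Fin n → X` and
every `n × n` matrix `A` of relations among the `x j`, the image `J''(det A)` lies in `(G₂)`.
Over the UFD `Λ₂` one has `Fitt₀ ⊆ char`, so S3a's equality `J''(char X) = (G₂)` implies this; the converse fails
(Fitting remembers codimension 2), which is exactly the slack `gcd(u₁ − 1, u₂ − 1)` priced by `H_A5`. -/
def DetLeSpan (X : Type) [AddCommGroup X] [Module (IwasawaAlgebra₂ 2) X]
    (G₂ : PowerSeries (PowerSeries (PadicComplexInt 2))) (J : ℤ_[2] →+* PadicComplexInt 2) : Prop :=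
  ∀ (n : ℕ) (x : Fin n → X), Submodule.span (IwasawaAlgebra₂ 2) (Set.range x) = ⊤ →
    ∀ A : Matrix (Fin n) (Fin n) (IwasawaAlgebra₂ 2), (∀ i, ∑ j, A i j • x j = 0) →
      PowerSeries.map (PowerSeries.map J) A.det ∈ Ideal.span {G₂}

/-- **H_A0 (bridge from S3a; sorried helper, size M; needs `Λ₂` a UFD — true (regular local ring of dimension 3)
but absent from Mathlib, whose `UniqueFactorizationMonoid R⟦X⟧` wants `R` a PID; taken as a hypothesis).**
Over a Noetherian UFD, `Fitt₀(X) ⊆ char(X) = ∏_{ht 𝔭 = 1} 𝔭^{ℓ_𝔭(X)}` for f.g. torsion `X` (localise at each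
height-one `𝔭 = (f)`: `Fitt₀(X_𝔭) = 𝔭^{ℓ_𝔭}`; intersect the finitely many principal `(f^{ℓ})`). Hence S3a's
`J''(char X) = (G₂)` (`stub_twoVariableMC_two`, v10.2 :225) implies `(E₂-Fitt♭)`; the converse is false in
general (the Fitting ideal sees codimension two). Not needed if `(E₂-Fitt♭)` is supplied directly. -/
theorem H_A0_detLeSpan_of_charIdeal_eq (hufd : UniqueFactorizationMonoid (IwasawaAlgebra₂ 2))
    (X : Type) [AddCommGroup X] [Module (IwasawaAlgebra₂ 2) X] [Module.Finite (IwasawaAlgebra₂ 2) X]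
    (htors : Module.IsTorsion (IwasawaAlgebra₂ 2) X)
    (G₂ : PowerSeries (PowerSeries (PadicComplexInt 2))) (J : ℤ_[2] →+* PadicComplexInt 2)
    (hS3a : (Module.charIdeal (IwasawaAlgebra₂ 2) X).map (PowerSeries.map (PowerSeries.map J)) =
      Ideal.span {G₂}) :
    DetLeSpan X G₂ J := by
  sorry

/-! ## §2 `H_A1` — POINT DESCENT BY FITTING BASE CHANGE (the load-bearing new lemma)

`Fitt` commutes with base change (`Fitt_{Λ₂/𝔞}(X/𝔞X) = Fitt_{Λ₂}(X)·(Λ₂/𝔞)`, Prop. 1.1 (ii)), `Λ₂/𝔞_{a,b} ≅ ℤ₂`,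
and for a FINITE `ℤ₂`-module `Fitt_{ℤ₂} = (#)` (elementary divisors). Hence `#(X/𝔞X) = 2^k` and `(E₂-Fitt♭)`
give `G₂(a,b) ∣ 2^k · (unit)` in `𝓘`, i.e. `‖G₂(a,b)‖ ≥ 2^{-k}`: a LOWER bound for the value from an UPPER
containment of ideals, with no characteristic ideal, no structure theorem over `Λ₂`, no pseudo-null error term,
no `μ = 0`, and — the point — NO INTERMEDIATE `ℤ₂`-LINE. -/

/-- **H_A1 (point descent, sorried helper; size M).** Proof plan: every relation matrix of `X/𝔞X` over
`ℤ₂ = Λ₂/𝔞` lifts to a relation matrix `A` over `Λ₂` with `A ≡ B (mod 𝔞)` (generators of `𝔞X` are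
`Λ₂`-combinations of the `x j`); Smith normal form over the PID `ℤ₂` gives `B` with `det B = 2^k · unit`;
`J''(det A) = G₂ · H` with `H` integral; evaluate at `(J a, J b)` with `IntSeries.HasValueAt₂` (values of integral
series at integral points have norm `≤ 1`, tree ns `…Theorems.IwasawaTwoVariable`): `2^{-k} = ‖det B‖ ≤ ‖val‖`. -/
theorem H_A1_norm_value_ge_of_detLeSpan
    (X : Type) [AddCommGroup X] [Module (IwasawaAlgebra₂ 2) X] [Module.Finite (IwasawaAlgebra₂ 2) X]
    (G₂ : PowerSeries (PowerSeries (PadicComplexInt 2))) (J : ℤ_[2] →+* PadicComplexInt 2)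
    (hJ : ∀ x : ℤ_[2], ((J x : PadicComplexInt 2) : ℂ_[2]) = ((x : ℚ_[2]) : ℂ_[2]))
    (hE : DetLeSpan X G₂ J) (a b : ℤ_[2]) (ha : ‖a‖ < 1) (hb : ‖b‖ < 1) (k : ℕ)
    (hk : Nat.card (X ⧸ pointIdeal a b • (⊤ : Submodule (IwasawaAlgebra₂ 2) X)) = 2 ^ k)
    (val : ℂ_[2])
    (hval : IntSeries.HasValueAt₂ G₂ ((a : ℚ_[2]) : ℂ_[2]) ((b : ℚ_[2]) : ℂ_[2]) val) :
    (2 : ℝ) ^ (-(k : ℤ)) ≤ ‖val‖ := by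
  sorry

/-! ## §3 `H_A5` — the `v̄`-adic price of skipping the line: Koszul `H¹` of `ℤ₂² = ⟨γ₁, γ₂⟩` on `W*(K̃_w)`

For a discrete `2`-primary `𝒢_w = ℤ₂²`-module `D` with `φᵢ = γᵢ − 1` commuting and `φ₁` SURJECTIVE (i.e. `u₁ ≠ 1`
on a divisible `D`), `H¹(ℤ₂², D) ≅ Z¹/B¹ ≅ ker φ₁ / φ₂(ker φ₁)`; for `D = W* ≅ ℚ₂/ℤ₂(u₁, u₂)` this is
`ℤ/2^{min(ord₂(u₁−1), ord₂(u₂−1))}` — FINITE because `ρ_{W*}|_{I_v̄}` has infinite image (some `uᵢ ≠ 1`), where the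
LINE version `H¹(ℤ₂, D) = D/(u−1)D` resp. `Hom(ℤ₂, D)` is infinite when the line character is trivial at `w`
(the critic's kill-switch R12 on keys (1,3), (0,7)). -/

/-- Koszul `1`-cocycles of a commuting pair: `{(x, y) | φ₂ x = φ₁ y}`. -/
def koszulZ1 {D : Type} [AddCommGroup D] (φ₁ φ₂ : D →+ D) : AddSubgroup (D × D) :=
  (φ₂.comp (AddMonoidHom.fst D D) - φ₁.comp (AddMonoidHom.snd D D)).ker

/-- Koszul `1`-coboundaries: `{(φ₁ z, φ₂ z)}`. -/
def koszulB1 {D : Type} [AddCommGroup D] (φ₁ φ₂ : D →+ D) : AddSubgroup (D × D) :=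
  (φ₁.prod φ₂).range

/-- Membership in the Koszul cocycles (definitional unfolding). -/
theorem mem_koszulZ1_iff {D : Type} [AddCommGroup D] (φ₁ φ₂ : D →+ D) (v : D × D) :
    v ∈ koszulZ1 φ₁ φ₂ ↔ φ₂ v.1 = φ₁ v.2 := by
  simp [koszulZ1, AddMonoidHom.mem_ker, sub_eq_zero]

/-- Membership in the Koszul coboundaries (definitional unfolding). -/
theorem mem_koszulB1_iff {D : Type} [AddCommGroup D] (φ₁ φ₂ : D →+ D) (v : D × D) :
    v ∈ koszulB1 φ₁ φ₂ ↔ ∃ z, (φ₁ z, φ₂ z) = v := by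
  simp [koszulB1, AddMonoidHom.mem_range, AddMonoidHom.prod_apply]

/-- **H_A5 (Koszul count; PROVED, size S).** The canonical map `y₀ ↦ [(0, y₀)]` induces
`ker φ₁ / φ₂(ker φ₁) ≅ Z¹/B¹` when `φ₁` is surjective (inverse of `(x, y) ↦ y − φ₂ z`, `φ₁ z = x`). -/
theorem H_A5_card_koszulH1 {D : Type} [AddCommGroup D] (φ₁ φ₂ : D →+ D)
    (hcomm : φ₁.comp φ₂ = φ₂.comp φ₁) (hsurj : Function.Surjective φ₁) :
    Nat.card (koszulZ1 φ₁ φ₂ ⧸ (koszulB1 φ₁ φ₂).addSubgroupOf (koszulZ1 φ₁ φ₂)) =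
      Nat.card (φ₁.ker ⧸ (φ₁.ker.map φ₂).addSubgroupOf φ₁.ker) := by
  classical
  have hc : ∀ z, φ₁ (φ₂ z) = φ₂ (φ₁ z) := fun z ↦ by
    simpa using congrArg (fun f : D →+ D ↦ f z) hcomm
  set Z := koszulZ1 φ₁ φ₂ with hZ
  set B := (koszulB1 φ₁ φ₂).addSubgroupOf Z with hB
  have hmemZ : ∀ y₀ : φ₁.ker, ((0 : D), (y₀ : D)) ∈ Z := by
    intro y₀
    rw [hZ, mem_koszulZ1_iff]
    have := y₀.2
    rw [AddMonoidHom.mem_ker] at this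
    simp [this]
  let g₀ : φ₁.ker →+ Z :=
    { toFun := fun y₀ ↦ ⟨((0 : D), (y₀ : D)), hmemZ y₀⟩
      map_zero' := by ext <;> simp
      map_add' := by intro a b; ext <;> simp }
  let g : φ₁.ker →+ Z ⧸ B := (QuotientAddGroup.mk' B).comp g₀
  have hg_surj : Function.Surjective g := by
    intro q
    obtain ⟨⟨⟨x, y⟩, hxy⟩, rfl⟩ := QuotientAddGroup.mk'_surjective B q
    obtain ⟨z, hz⟩ := hsurj x
    have hxy' : φ₂ x = φ₁ y := (mem_koszulZ1_iff φ₁ φ₂ _).1 (hZ ▸ hxy)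
    have hmem : y - φ₂ z ∈ φ₁.ker := by
      rw [AddMonoidHom.mem_ker, map_sub, hc, hz, hxy', sub_self]
    have hwZ : (φ₁ z, φ₂ z) ∈ Z := by
      rw [hZ, mem_koszulZ1_iff]; exact (hc z).symm
    refine ⟨⟨y - φ₂ z, hmem⟩, ?_⟩
    change QuotientAddGroup.mk' B (g₀ ⟨y - φ₂ z, hmem⟩) = QuotientAddGroup.mk' B ⟨(x, y), hxy⟩
    rw [QuotientAddGroup.mk'_eq_mk']
    refine ⟨⟨(φ₁ z, φ₂ z), hwZ⟩, ?_, ?_⟩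
    · rw [hB, AddSubgroup.mem_addSubgroupOf, mem_koszulB1_iff]
      exact ⟨z, rfl⟩
    · ext <;> simp [g₀, hz]
  have hg_ker : g.ker = (φ₁.ker.map φ₂).addSubgroupOf φ₁.ker := by
    ext y₀
    rw [AddMonoidHom.mem_ker, AddSubgroup.mem_addSubgroupOf, AddSubgroup.mem_map]
    change QuotientAddGroup.mk' B (g₀ y₀) = 0 ↔ _
    rw [QuotientAddGroup.mk'_apply, QuotientAddGroup.eq_zero_iff, hB, AddSubgroup.mem_addSubgroupOf,
      mem_koszulB1_iff]
    constructor
    · rintro ⟨z, hz⟩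
      have h1 : φ₁ z = 0 := by simpa [g₀] using congrArg Prod.fst hz
      have h2 : φ₂ z = y₀ := by simpa [g₀] using congrArg Prod.snd hz
      exact ⟨z, (AddMonoidHom.mem_ker).2 h1, h2⟩
    · rintro ⟨z, hz1, hz2⟩
      refine ⟨z, ?_⟩
      rw [AddMonoidHom.mem_ker] at hz1
      ext <;> simp [g₀, hz1, hz2]
  calc Nat.card (Z ⧸ B) = Nat.card (φ₁.ker ⧸ g.ker) :=
        (Nat.card_congr (QuotientAddGroup.quotientKerEquivOfSurjective g hg_surj).toEquiv).symm
    _ = Nat.card (φ₁.ker ⧸ (φ₁.ker.map φ₂).addSubgroupOf φ₁.ker) := by rw [hg_ker]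

/-! ## §4 `H_A4` — DIRECT one-sided `ℤ₂²`-control `K₀ → K̃_∞` for Agboola's restricted Selmer groups

Typed over the tree's generic carriers (`Agboola2007.restrictedSelmer H M 2 v̄` for `H = ⊤` and
`H = pairKer κ₁ κ₂`; `resOfLe`; `conjH1`). Two genuinely two-variable terms replace the line's: the GLOBAL lifting
defect `H²(ℤ₂², M(K̃_∞)) ≅ M(K̃_∞)_{𝒢}` (zero for a procyclic group — the tree's
`exists_resOfLe_eq_of_conjH1_eq` — at most ONE bit here since `W*(K̃_∞)_{𝒢}` has order `≤ 2`), and the `v̄`-LOCAL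
kernel `H¹(𝒢_w, M(K̃_w))` of `H_A5`. One-sided = only the inequality the LOWER bound consumes. -/

/-- `M^{H}` — the fixed points of a subgroup `H ≤ Γ_K` as an additive subgroup (for `H = pairKer κ₁ κ₂` this is
`M(K̃_∞)`). -/
def fixedSub {K : Type} [Field K] (H : Subgroup (absoluteGaloisGroup K)) (M : Type) [AddCommGroup M]
    [DistribMulAction (absoluteGaloisGroup K) M] : AddSubgroup M :=
  ⨅ g ∈ H, (DistribMulAction.toAddMonoidHom M g - AddMonoidHom.id M).ker

/-- `γ − 1` as an additive endomorphism of `M`. -/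
def subOne {K : Type} [Field K] (M : Type) [AddCommGroup M] [DistribMulAction (absoluteGaloisGroup K) M]
    (γ : absoluteGaloisGroup K) : M →+ M :=
  DistribMulAction.toAddMonoidHom M γ - AddMonoidHom.id M

/-- **H_A4 (two-variable one-sided control, sorried helper; size M).** `#𝔖_{v̄}(K̃_∞, M)^{γ₁,γ₂} ≤ #𝔖_{v̄}(K₀, M) ·
2^{c_glob} · 2^{c_loc}`, where `2^{c_glob}` bounds the coinvariants `M(K̃_∞)_{𝒢} ≅ H²(𝒢, M(K̃_∞))` (the
two-step lifting defect through `exists_resOfLe_eq_of_conjH1_eq` applied twice) and `2^{c_loc}` bounds the local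
correction defect (classes of `H¹(K₀, M)` whose restriction is Selmer, modulo Selmer classes and `ker res`; its
`v̄`-part is `H_A5`). -/
theorem H_A4_card_inv_restrictedSelmer₂_le
    {K : Type} [Field K] [NumberField K] (κ₁ κ₂ : ZpExtension K 2) (γ₁ γ₂ : absoluteGaloisGroup K)
    (hγ : ZpExtension.IsTopGeneratorPair κ₁ κ₂ γ₁ γ₂)
    (M : Type) [AddCommGroup M] [DistribMulAction (absoluteGaloisGroup K) M] [TopologicalSpace M]
    [DiscreteTopology M] (hcont : ∀ m : M, Continuous fun g : absoluteGaloisGroup K ↦ g • m)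
    (hprim : ∀ m : M, ∃ k : ℕ, 2 ^ k • m = 0) (vbar : HeightOneSpectrum (𝓞 K))
    (cglob cloc : ℕ)
    (hglob : Nat.card
        (fixedSub (ZpExtension.pairKer κ₁ κ₂) M ⧸
          (((fixedSub (ZpExtension.pairKer κ₁ κ₂) M).map (subOne M γ₁) ⊔
              (fixedSub (ZpExtension.pairKer κ₁ κ₂) M).map (subOne M γ₂)).addSubgroupOf
            (fixedSub (ZpExtension.pairKer κ₁ κ₂) M))) ≤ 2 ^ cglob)
    (hloc : Nat.card
        ((Agboola2007.restrictedSelmer (ZpExtension.pairKer κ₁ κ₂) M 2 vbar).comap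
            (resOfLe M (le_top : ZpExtension.pairKer κ₁ κ₂ ≤ ⊤)) ⧸
          ((Agboola2007.restrictedSelmer ⊤ M 2 vbar ⊔
              (resOfLe M (le_top : ZpExtension.pairKer κ₁ κ₂ ≤ ⊤)).ker).addSubgroupOf
            ((Agboola2007.restrictedSelmer (ZpExtension.pairKer κ₁ κ₂) M 2 vbar).comap
              (resOfLe M (le_top : ZpExtension.pairKer κ₁ κ₂ ≤ ⊤))))) ≤ 2 ^ cloc)
    (hfin : Finite (Agboola2007.restrictedSelmer (⊤ : Subgroup (absoluteGaloisGroup K)) M 2 vbar)) :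
    Nat.card
        ((Agboola2007.restrictedSelmer (ZpExtension.pairKer κ₁ κ₂) M 2 vbar) ⊓
          ((conjH1 (ZpExtension.pairKer κ₁ κ₂) M γ₁ - AddMonoidHom.id _).ker ⊓
            (conjH1 (ZpExtension.pairKer κ₁ κ₂) M γ₂ - AddMonoidHom.id _).ker) : AddSubgroup _) ≤
      Nat.card (Agboola2007.restrictedSelmer (⊤ : Subgroup (absoluteGaloisGroup K)) M 2 vbar) *
        2 ^ cglob * 2 ^ cloc := by
  sorry

/-! ## §5 The bookkeeping the stub consumes (proved): how `H_A1` + `H_A4` + the shared bottom split `V1` give the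
stub's inequality `2·ord₂[E(K):ℤP] − 2·ord₂ c ≤ ord₂ #Ш[2^∞] + ord₂ Tam`, up to the budget `c` (critic's hcal). -/

/-- **lower_chain (proved bookkeeping).** From (i) `m ≤ k` (H_A1 read in valuations: `ord₂ value ≤ ord₂ #X/𝔞X`),
(ii) `k ≤ s + c` (H_A4: two-variable control, `c = c_glob + c_loc`), (iii) `s = sha + t` (V1: the bottom group splits
off `Ш[v̄^∞]` and a Tamagawa/torsion part), (iv) `m = h − d` (S2′: the value is the Heegner-index side), conclude
`h − d ≤ sha + t + c`. -/
theorem lower_chain (m k s c sha t h d : ℤ) (h1 : m ≤ k) (h2 : k ≤ s + c) (h3 : s = sha + t)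
    (h4 : m = h - d) : h - d ≤ sha + t + c := by
  omega

end Summit.BirchSwinnertonDyer.BirchSwinnertonDyer.Cruxes.SplitBadTwoLowerHalfOfFacts.StubIdeasK1G4
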